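import Literature.NumberTheory.Transcendental.KaehlerHodgeAdjointProofs
import HarnessLib

/-!
# `cl2Inner_dolbeaultBar_left`: corrected statement (holomorphic atlas as a binder) and discharge

`Literature/NumberTheory/Transcendental/KaehlerHodge.lean` renders Huybrechts' Lemma 3.2.3
(*Complex Geometry* (2005), p. 126: on a compact hermitian manifold `∂^*` and `∂̄^*` are the formal
adjoints of `∂` and `∂̄` for `(α, β) = ∫_X g_ℂ(α, β) * 1`, Def. 3.2.1; `∂̄* = -*∂*`, Def. 3.1.3) as the
named fact `Literature.NumberTheory.Transcendental.cl2Inner_dolbeaultBar_left g o`. That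
`def … : Prop` (an M5 mechanical rewrite of a sorried theorem) abstracts only the section variables
its body uses: its binders are `E, M, k, m, [FiniteDimensional ℂ E], n, [Fact (finrank ℝ E = n)],
[IsManifold 𝓘(ℝ, E) ∞ M], g, o` — the **holomorphic atlas** `[IsManifold 𝓘(ℂ, E) ω M]` of the
section is *not* among them (the metric `g` is typed over the real `C^∞` structure only). As
elaborated it therefore speaks about every compact `C^∞` real manifold charted on the complex
vector space `E`, with `J_x = i •` read in the arbitrary preferred chart `chartAt x`; the type
projections and `∂̄ = ∑ (d α^{p,q})^{p,q+1}` are then chart-wise junk and the statement is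
**false** (flat torus with identity charts on an open dense set and conjugation charts on a fat
Cantor set `K` of positive measure, flat metric, `α = f`, `β = dz̄`: `∂̄*β = 0` while
`∂̄f = f_{z̄} dz̄` off `K` and `f_z dz` on `K`, so `⟪∂̄f, β⟫ - ⟪f, ∂̄*β⟫ = -2∫_K conj(f_{z̄}) ≠ 0` for
suitable `f`; details in the module docstring of `KaehlerHodgeAdjointProofs.lean`), exactly as for
the sibling facts `finite_dolbeaultHarmonicForms` (`KaehlerHodgeComplexAtlasFact.lean`) and
`cHodgeLaplacian_eq_two_smul_dolbeaultLaplacian` (`KaehlerHodge.lean`, §*KaehlerCorrected*).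

This file records the **corrected statement** `cl2Inner_dolbeaultBar_left_of_isManifold`, with the
holomorphic atlas as an explicit binder of the `def` and the body unchanged (the definitional `iff`
with the old `Prop` at a complex manifold, `cl2Inner_dolbeaultBar_left_of_isManifold_iff`), and
**discharges** it (`cl2Inner_dolbeaultBar_left_of_isManifold_holds`) by the theorem
`cl2Inner_dolbeaultBar_left_of_isManifoldComplex` of `KaehlerHodgeAdjointProofs.lean`, where
Lemma 3.2.3 is proved (`Literature.Geometry.Kaehler.MForm.cl2Inner_dolbeaultBar_left_of_isHermitian`).
The old def has no dependents.

## References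

* D. Huybrechts, *Complex Geometry. An Introduction*, Universitext, Springer (2005), §3.1,
  Def. 3.1.3, p. 115; §3.2, Def. 3.2.1, Prop. 3.2.2 (ii), p. 125, Lemma 3.2.3, p. 126.
* C. Voisin, *Hodge Theory and Complex Algebraic Geometry I* (2002), §5.1.1–5.1.3.
* P. Griffiths, J. Harris, *Principles of Algebraic Geometry* (1978), p. 82.
-/

noncomputable section

open scoped Manifold ContDiff Topology
open Bundle Module

namespace Literature.NumberTheory.Transcendental

open Literature.Geometry.Kaehler

variable {E : Type*} [NormedAddCommGroup E] [NormedSpace ℂ E]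
  {M : Type*} [TopologicalSpace M] [ChartedSpace E M] {k m : ℕ}
  [FiniteDimensional ℂ E] {n : ℕ} [Fact (finrank ℝ E = n)] [IsManifold 𝓘(ℝ, E) ∞ M]
  (g : ContMDiffRiemannianMetric 𝓘(ℝ, E) ∞ E (fun x : M ↦ TangentSpace 𝓘(ℝ, E) x))
  (o : (x : M) → Orientation ℝ (TangentSpace 𝓘(ℝ, E) x) (Fin n))

/-- **`∂̄*` is the `L²`-adjoint of `∂̄` on a compact Hermitian manifold — corrected statement of
the named fact `Literature.NumberTheory.Transcendental.cl2Inner_dolbeaultBar_left`**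
(D. Huybrechts, *Complex Geometry* (2005), Lemma 3.2.3, p. 126: on a compact hermitian manifold
`∂^*` and `∂̄^*` are the formal adjoints of `∂` and `∂̄` for `(α, β) = ∫_X g_ℂ(α, β) * 1`
(Def. 3.2.1); `∂̄* = -*∂*`, Def. 3.1.3, p. 115; Voisin (2002), §5.1.1; Griffiths–Harris (1978),
p. 82). For a **complex** manifold `M` (holomorphic atlas `[IsManifold 𝓘(ℂ, E) ω M]`, an explicit
binder of this `def`) that is compact and Hausdorff, a smooth Riemannian metric `g` on the real
tangent bundle which is Hermitian, and an orientation family `o` with smooth volume form: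
`⟪∂̄α, β⟫ = ⟪α, ∂̄*β⟫` for smooth complex forms `α ∈ A^k_ℂ`, `β ∈ A^{k+1}_ℂ` (`h : (k + 1) + m = n`;
`⟪·,·⟫ = MForm.cl2Inner o`, conjugate-linear in the first slot; `∂̄* = dolbeaultBarAdjoint o h`).

**Discrepancy with the original.** `def cl2Inner_dolbeaultBar_left` abstracts only the section
instances its body uses, and the holomorphic atlas is not among them (`#print`: binders
`[FiniteDimensional ℂ E] [Fact (finrank ℝ E = n)] [IsManifold 𝓘(ℝ, E) ∞ M] (g) (o)` only). As
elaborated it therefore asserts the identity for every smooth real atlas on a manifold charted on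
`E`, where `J_x = i •` is read in the arbitrary preferred chart `chartAt x`, the type projections
and `∂̄ = ∑ (d α^{p,q})^{p,q+1}` are chart-wise junk, and the identity **fails** (flat torus with
identity charts on an open dense set and conjugation charts `z ↦ conj z + c` on a fat Cantor set `K`
of positive measure, flat metric — smooth and Hermitian —, `α = f`, `β = dz̄`: then `∂̄*β = 0`
while `∂̄f = f_{z̄} dz̄` off `K` and `f_z dz` on `K`, so `⟪∂̄f, β⟫ - ⟪f, ∂̄*β⟫ = -2∫_K conj(f_{z̄})
≠ 0` for suitable `f`; see the module docstring of `KaehlerHodgeAdjointProofs.lean`). Same body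
otherwise (`cl2Inner_dolbeaultBar_left_of_isManifold_iff`); the pattern is that of
`finite_dolbeaultHarmonicForms_of_isManifold` (`KaehlerHodgeComplexAtlasFact.lean`). Discharged by
`cl2Inner_dolbeaultBar_left_of_isManifold_holds`; the usable form is
`Literature.Geometry.Kaehler.MForm.cl2Inner_dolbeaultBar_left_of_isHermitian`.
[cite: Huybrechts2005, Lemma 3.2.3] -/
def cl2Inner_dolbeaultBar_left_of_isManifold [IsManifold 𝓘(ℂ, E) ω M] : Prop :=
  ∀ [MeasurableSpace E] [BorelSpace E] [CompactSpace M] [T2Space M]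
    (hg : g.toRiemannianMetric.IsHermitian) (h : (k + 1) + m = n)
    {α : MForm 𝓘(ℝ, E) M ℂ k} {β : MForm 𝓘(ℝ, E) M ℂ (k + 1)}
    (hα : IsSmoothForm α) (hβ : IsSmoothForm β),
    letI : RiemannianBundle (fun x : M ↦ TangentSpace 𝓘(ℝ, E) x) := ⟨g.toRiemannianMetric⟩
    IsSmoothForm (riemannianVolumeForm o) →
      MForm.cl2Inner o (dolbeaultBar α) β = MForm.cl2Inner o α (dolbeaultBarAdjoint o h β)

/-- At a complex manifold the corrected fact *is* the old `Prop` `cl2Inner_dolbeaultBar_left g o`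
(same body), so the discharge below serves both. [folklore] -/
theorem cl2Inner_dolbeaultBar_left_of_isManifold_iff [IsManifold 𝓘(ℂ, E) ω M] :
    cl2Inner_dolbeaultBar_left_of_isManifold (k := k) (m := m) g o ↔
      cl2Inner_dolbeaultBar_left (k := k) (m := m) g o :=
  Iff.rfl

/-- **Discharge** of the corrected named fact `cl2Inner_dolbeaultBar_left_of_isManifold`
(Huybrechts (2005), Lemma 3.2.3, p. 126): `cl2Inner_dolbeaultBar_left_of_isManifoldComplex`
through `cl2Inner_dolbeaultBar_left_of_isManifold_iff`. [cite: Huybrechts2005, Lemma 3.2.3] -/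
theorem cl2Inner_dolbeaultBar_left_of_isManifold_holds [IsManifold 𝓘(ℂ, E) ω M] :
    cl2Inner_dolbeaultBar_left_of_isManifold (k := k) (m := m) g o :=
  (cl2Inner_dolbeaultBar_left_of_isManifold_iff g o).2
    (cl2Inner_dolbeaultBar_left_of_isManifoldComplex g o)

end Literature.NumberTheory.Transcendental
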